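import Mathlib
import HarnessLib
import Summits.ValiantsHypothesis.ValiantsHypothesis.Theorems.LacunarySymmetroidMatrixDescartesProductPlusOneRealRooted

/-!
# LINE (A) `product_plus_one` (crux `MatrixDescartes`, stmt-ValiantsHypothesis-18050, V1) — W-currency, real-rooted polynomials:
# the GLOBAL COUNT `Z₊(W(P)) ≤ B + B_mult ≤ 2·B_mult` (dense-regime bookkeeping; a corollary of the window law)

Companion of ✓ `…RealRooted` (window law: ≤ 2 roots of `W(P) = P·θ(θP) − (θP)²` per inner window, ≤ 1 per outer window, for real-rooted `P`).
Summing the windows with the separator count ✓ `card_le_two_mul_card_add_two` and adding the roots of `W(P)` AT roots of `P` (a positive root of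
`P` is a root of `W(P)` iff it is a MULTIPLE root — `W = −(θP)²` there; `one_lt_rootMultiplicity_iff_isRoot`):

* `card_posRoots_logWronskian_le_of_realRooted` — `Z₊(W(P)) ≤ B + B_mult` (`B` distinct positive roots of `P`, `B_mult` with multiplicity; no positive
  root ⇒ `W(P)` has no positive root: the root kernel is `< 0`, or `P` is a monomial and `W(P) = 0`);
* `card_posRoots_logWronskian_le_two_mul` — `Z₊(W(P)) ≤ 2·B_mult`.

Honest framing (pen val-idea-25 g4 memo §18.1/§18.2, crit-6 #53): for real-rooted `P` the TOTAL is already bounded by degree (`W = X·N`,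
`deg N ≤ 2 deg P − 2`, multiplicity `2μ − 2` at each nonzero root of multiplicity `μ` ⇒ `≤ 2R − 2` real roots off the roots), and real-rooted fewnomial
rows are dense (degree ≤ 3 after deflation) — so this count is BOOKKEEPING, NOT a rung of / evidence for `WronskianBudgetK3` (EB2-W); the per-window
distribution (✓ `…RealRooted`) is the content.  `WronskianBudgetK3` / `OneChangeFloorK3` / `stub_polyLaw` / `MatrixDescartes` / B NOT proved;
`VP ≠ VNP` NOT proved.  No definitions, no named facts; Mathlib + ✓ lane modules only.
-/

set_option linter.dupNamespace false

namespace Summit.ValiantsHypothesis.ValiantsHypothesis.Theorems.LacunarySymmetroidMatrixDescartes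

namespace ProductPlusOne

open Polynomial Finset Set
open scoped BigOperators

/-- **Global count** (corollary of the window law; dense-regime bookkeeping, NOT an EB2-W rung): for every real-rooted real polynomial `P`
(`P.roots.card = P.natDegree`), `Z₊(P·θ(θP) − (θP)²) ≤ B + B_mult` where `B` is the number of DISTINCT positive roots of `P` and `B_mult` the number
of positive roots counted WITH multiplicity. [this file's theorem] -/
theorem card_posRoots_logWronskian_le_of_realRooted (P : ℝ[X]) (hsplit : Multiset.card P.roots = P.natDegree) :
    ((P * (X * derivative (X * derivative P)) - (X * derivative P) ^ 2).roots.toFinset.filter (fun t => 0 < t)).card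
      ≤ (P.roots.toFinset.filter (fun t => 0 < t)).card + Multiset.card (P.roots.filter (fun t => 0 < t)) := by
  classical
  set W : ℝ[X] := P * (X * derivative (X * derivative P)) - (X * derivative P) ^ 2 with hWdef
  set R := P.roots.toFinset.filter (fun t => 0 < t) with hR
  by_cases hW : W = 0
  · have : (W.roots.toFinset.filter (fun t => 0 < t)) = ∅ := by
      rw [hW, roots_zero, Multiset.toFinset_zero, Finset.filter_empty]
    rw [this, Finset.card_empty]; exact Nat.zero_le _
  have hP : P ≠ 0 := by
    rintro rfl
    exact hW (by rw [hWdef]; simp)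
  set ZW := W.roots.toFinset.filter (fun t => 0 < t) with hZW
  -- the root kernel `F` and the dictionary
  set w : ℝ → ℝ := fun ρ => (P.roots.count ρ : ℝ) with hw
  have hwpos : ∀ ρ ∈ P.roots.toFinset, 0 < w ρ := fun ρ hρ => by
    show (0 : ℝ) < (P.roots.count ρ : ℝ)
    exact_mod_cast Multiset.count_pos.2 (Multiset.mem_toFinset.1 hρ)
  have hdict : ∀ t, P.eval t ≠ 0 → W.eval t = -t * (P.eval t) ^ 2 * ∑ ρ ∈ P.roots.toFinset, w ρ * ρ / (t - ρ) ^ 2 :=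
    fun t ht => logWronskian_eval_of_splits P hP hsplit t ht
  have hmemZW : ∀ t, t ∈ ZW ↔ W.eval t = 0 ∧ 0 < t := fun t => by
    rw [hZW, Finset.mem_filter, Multiset.mem_toFinset, mem_roots hW, IsRoot.def]
  have hmemR : ∀ r, r ∈ R ↔ P.eval r = 0 ∧ 0 < r := fun r => by
    rw [hR, Finset.mem_filter, Multiset.mem_toFinset, mem_roots hP, IsRoot.def]
  -- zeros of `W` off the roots are zeros of `F`
  have hFzero : ∀ t ∈ ZW, P.eval t ≠ 0 → ∑ ρ ∈ P.roots.toFinset, w ρ * ρ / (t - ρ) ^ 2 = 0 := by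
    intro t ht hPt
    obtain ⟨hWt, ht0⟩ := (hmemZW t).1 ht
    rw [hdict t hPt] at hWt
    have h1 : -t * (P.eval t) ^ 2 ≠ 0 := mul_ne_zero (neg_ne_zero.2 (ne_of_gt ht0)) (pow_ne_zero 2 hPt)
    exact (mul_eq_zero.1 hWt).resolve_left h1
  -- split `ZW` into zeros OFF the roots (`T`) and AT roots (`T'`)
  set T := ZW.filter (fun t => P.eval t ≠ 0) with hT
  set T' := ZW.filter (fun t => ¬ P.eval t ≠ 0) with hT'
  have hsplit' : T.card + T'.card = ZW.card := Finset.card_filter_add_card_filter_not _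
  -- (i) zeros AT roots are multiple roots: `|R| + |T'| ≤ B_mult`
  set R₂ := R.filter (fun r => (derivative P).IsRoot r) with hR₂
  have hT'sub : T' ⊆ R₂ := by
    intro t ht
    rw [hT', Finset.mem_filter, not_not] at ht
    obtain ⟨htZ, hPt⟩ := ht
    obtain ⟨hWt, ht0⟩ := (hmemZW t).1 htZ
    rw [hR₂, Finset.mem_filter, hmemR]
    refine ⟨⟨hPt, ht0⟩, ?_⟩
    have : W.eval t = -(t * (derivative P).eval t) ^ 2 := by
      rw [hWdef, eval_sub, eval_mul, hPt, zero_mul, zero_sub, eval_pow, eval_mul, eval_X]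
    rw [this, neg_eq_zero, sq_eq_zero_iff, mul_eq_zero] at hWt
    exact hWt.resolve_left (ne_of_gt ht0)
  have hmult : R.card + R₂.card ≤ Multiset.card (P.roots.filter (fun t => 0 < t)) := by
    have hcount : Multiset.card (P.roots.filter (fun t => 0 < t)) = ∑ r ∈ R, P.roots.count r := by
      rw [← Multiset.toFinset_sum_count_eq, Multiset.toFinset_filter]
      refine Finset.sum_congr rfl fun r hr => ?_
      rw [Multiset.count_filter_of_pos ((Finset.mem_filter.1 hr).2)]
    have hc1 : R₂.card = ∑ r ∈ R, if (derivative P).IsRoot r then 1 else 0 := by rw [hR₂, Finset.card_filter]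
    have hc2 : R.card = ∑ r ∈ R, 1 := Finset.card_eq_sum_ones R
    rw [hcount, hc1, hc2, ← Finset.sum_add_distrib]
    refine Finset.sum_le_sum fun r hr => ?_
    have hrroot : P.IsRoot r := by rw [IsRoot.def]; exact ((hmemR r).1 hr).1
    have h1 : 1 ≤ P.roots.count r := by
      rw [count_roots]; exact (rootMultiplicity_pos hP).2 hrroot
    split_ifs with hder
    · have h2 : 1 < P.roots.count r := by
        rw [count_roots]; exact (one_lt_rootMultiplicity_iff_isRoot hP).2 ⟨hrroot, hder⟩
      omega
    · omega
  have hT'le : T'.card ≤ R₂.card := Finset.card_le_card hT'sub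
  -- (ii) zeros OFF the roots: `|T| ≤ 2|R|`
  have hTle : T.card ≤ 2 * R.card := by
    have hmemT : ∀ t, t ∈ T ↔ (W.eval t = 0 ∧ 0 < t) ∧ P.eval t ≠ 0 := fun t => by
      rw [hT, Finset.mem_filter, hmemZW]
    -- some root of `P` is nonzero (else `W = 0`)
    have hnz : ∃ ρ ∈ P.roots.toFinset, ρ ≠ 0 := by
      by_contra hall
      push Not at hall
      apply hW
      refine eq_zero_of_infinite_isRoot W ((Set.Ioi_infinite (1 : ℝ)).mono fun t ht => ?_)
      have ht0 : (0 : ℝ) < t := zero_lt_one.trans ht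
      have hPt : P.eval t ≠ 0 := by
        intro hPt
        have : t ∈ P.roots.toFinset := by rw [Multiset.mem_toFinset, mem_roots hP]; exact hPt
        exact absurd (hall t this) (ne_of_gt ht0)
      rw [Set.mem_setOf_eq, IsRoot.def, hdict t hPt]
      have : ∑ ρ ∈ P.roots.toFinset, w ρ * ρ / (t - ρ) ^ 2 = 0 :=
        Finset.sum_eq_zero fun ρ hρ => by rw [hall ρ hρ]; simp
      rw [this, mul_zero]
    rcases R.eq_empty_or_nonempty with hRe | hRne
    · -- no positive root: `F < 0` off the roots on `(0,∞)`, so `T = ∅`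
      have hTe : T = ∅ := by
        rw [Finset.eq_empty_iff_forall_notMem]
        intro t ht
        obtain ⟨⟨hWt, ht0⟩, hPt⟩ := (hmemT t).1 ht
        have hF := hFzero t (Finset.mem_of_mem_filter t ht) hPt
        have hneg : ∑ ρ ∈ P.roots.toFinset, w ρ * ρ / (t - ρ) ^ 2 < 0 := by
          have hle : ∀ ρ ∈ P.roots.toFinset, ρ ≤ 0 := by
            intro ρ hρ
            by_contra hpos
            push Not at hpos
            have : ρ ∈ R := by
              rw [hmemR]; exact ⟨(mem_roots hP).1 (Multiset.mem_toFinset.1 hρ), hpos⟩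
            rw [hRe] at this; exact absurd this (Finset.notMem_empty ρ)
          obtain ⟨ρ₀, hρ₀, hρ₀0⟩ := hnz
          have hlt0 : ρ₀ < 0 := lt_of_le_of_ne (hle ρ₀ hρ₀) hρ₀0
          have hsum : 0 < ∑ ρ ∈ P.roots.toFinset, -(w ρ * ρ / (t - ρ) ^ 2) := by
            refine Finset.sum_pos' (fun ρ hρ => ?_) ⟨ρ₀, hρ₀, ?_⟩
            · have hc : 0 < t - ρ := by linarith [hle ρ hρ]
              have : 0 ≤ -(w ρ * ρ) := by nlinarith [(hwpos ρ hρ).le, hle ρ hρ]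
              rw [← neg_div]; positivity
            · have hc : 0 < t - ρ₀ := by linarith
              have : 0 < -(w ρ₀ * ρ₀) := by nlinarith [hwpos ρ₀ hρ₀]
              rw [← neg_div]; positivity
          rw [Finset.sum_neg_distrib] at hsum
          linarith
        exact absurd hF (ne_of_lt hneg)
      rw [hTe, Finset.card_empty]; exact Nat.zero_le _
    · -- positive roots exist
      set r₁ := R.min' hRne with hr₁
      set r₂ := R.max' hRne with hr₂
      have hr₁R : r₁ ∈ R := Finset.min'_mem R hRne
      have hr₂R : r₂ ∈ R := Finset.max'_mem R hRne
      have hr₁0 : 0 < r₁ := ((hmemR r₁).1 hr₁R).2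
      have hr₂0 : 0 < r₂ := ((hmemR r₂).1 hr₂R).2
      have hr₁root : r₁ ∈ P.roots.toFinset := Finset.mem_of_mem_filter r₁ hr₁R
      have hr₂root : r₂ ∈ P.roots.toFinset := Finset.mem_of_mem_filter r₂ hr₂R
      -- a root of `P` is either `≤ 0` or in `R`
      have hroot_cases : ∀ ρ ∈ P.roots.toFinset, ρ ≤ 0 ∨ ρ ∈ R := by
        intro ρ hρ
        rcases le_or_gt ρ 0 with h | h
        · exact Or.inl h
        · exact Or.inr ((hmemR ρ).2 ⟨(mem_roots hP).1 (Multiset.mem_toFinset.1 hρ), h⟩)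
      -- the three pieces of `T`
      set T₁ := T.filter (fun t => t < r₁) with hT₁
      set T₂ := T.filter (fun t => r₁ < t ∧ t < r₂) with hT₂
      set T₃ := T.filter (fun t => r₂ < t) with hT₃
      have hTsub : T ⊆ T₁ ∪ T₂ ∪ T₃ := by
        intro t ht
        have hPt := ((hmemT t).1 ht).2
        have htr₁ : t ≠ r₁ := fun h => hPt (h ▸ ((hmemR r₁).1 hr₁R).1)
        have htr₂ : t ≠ r₂ := fun h => hPt (h ▸ ((hmemR r₂).1 hr₂R).1)
        rcases lt_or_gt_of_ne htr₁ with h1 | h1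
        · exact Finset.mem_union.2 (Or.inl (Finset.mem_union.2 (Or.inl (Finset.mem_filter.2 ⟨ht, h1⟩))))
        rcases lt_or_gt_of_ne htr₂ with h2 | h2
        · exact Finset.mem_union.2 (Or.inl (Finset.mem_union.2 (Or.inr (Finset.mem_filter.2 ⟨ht, h1, h2⟩))))
        · exact Finset.mem_union.2 (Or.inr (Finset.mem_filter.2 ⟨ht, h2⟩))
      -- `|T₁| ≤ 1` (left outer window)
      have hT₁le : T₁.card ≤ 1 := by
        refine card_le_one_of_no_two T₁ fun x hx y hy hxy => ?_
        obtain ⟨hxT, hx₁⟩ := Finset.mem_filter.1 hx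
        obtain ⟨hyT, hy₁⟩ := Finset.mem_filter.1 hy
        obtain ⟨⟨_, hx0⟩, hPx⟩ := (hmemT x).1 hxT
        obtain ⟨⟨_, hy0⟩, hPy⟩ := (hmemT y).1 hyT
        refine rootKernel_leftOuter_no_two_zeros P.roots.toFinset w (fun ρ => ρ) hwpos hr₁0 (fun ρ hρ => ?_)
          ⟨r₁, hr₁root, ne_of_gt hr₁0⟩ ⟨hx0, hx₁⟩ ⟨hy0, hy₁⟩ hxy
          (hFzero x (Finset.mem_of_mem_filter x hxT) hPx) (hFzero y (Finset.mem_of_mem_filter y hyT) hPy)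
        rcases hroot_cases ρ hρ with h | h
        · exact Or.inl h
        · exact Or.inr (Finset.min'_le R ρ h)
      -- `|T₃| ≤ 1` (right outer window)
      have hT₃le : T₃.card ≤ 1 := by
        refine card_le_one_of_no_two T₃ fun x hx y hy hxy => ?_
        obtain ⟨hxT, hx₂⟩ := Finset.mem_filter.1 hx
        obtain ⟨hyT, hy₂⟩ := Finset.mem_filter.1 hy
        obtain ⟨⟨_, hx0⟩, hPx⟩ := (hmemT x).1 hxT
        obtain ⟨⟨_, hy0⟩, hPy⟩ := (hmemT y).1 hyT
        refine rootKernel_rightOuter_no_two_zeros P.roots.toFinset w (fun ρ => ρ) hwpos hr₂0 (fun ρ hρ => ?_)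
          ⟨r₂, hr₂root, hr₂0⟩ hx₂ hy₂ hxy
          (hFzero x (Finset.mem_of_mem_filter x hxT) hPx) (hFzero y (Finset.mem_of_mem_filter y hyT) hPy)
        rcases hroot_cases ρ hρ with h | h
        · exact h.trans hr₂0.le
        · exact Finset.le_max' R ρ h
      -- `|T₂| ≤ 2|R| − 2` (inner windows, separator count)
      have hT₂le : T₂.card + 2 ≤ 2 * R.card := by
        rcases eq_or_lt_of_le (Finset.min'_le R r₂ hr₂R) with h12 | h12
        · -- one positive root: `T₂ = ∅`
          have h12' : r₁ = r₂ := h12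
          have hTe : T₂ = ∅ := by
            rw [Finset.eq_empty_iff_forall_notMem]
            intro t ht
            obtain ⟨_, h1, h2⟩ := Finset.mem_filter.1 ht
            rw [h12'] at h1
            exact absurd (h1.trans h2) (lt_irrefl _)
          have : 1 ≤ R.card := Finset.card_pos.2 hRne
          rw [hTe, Finset.card_empty]; omega
        · have h12' : r₁ < r₂ := h12
          set R' := R.filter (fun r => r₁ < r ∧ r < r₂) with hR'
          have hR'card : R'.card + 2 ≤ R.card := by
            have hsub : R' ⊆ (R.erase r₁).erase r₂ := by
              intro r hr
              obtain ⟨hrR, h1, h2⟩ := Finset.mem_filter.1 hr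
              exact Finset.mem_erase.2 ⟨ne_of_lt h2, Finset.mem_erase.2 ⟨ne_of_gt h1, hrR⟩⟩
            have e1 : (R.erase r₁).card + 1 = R.card := Finset.card_erase_add_one hr₁R
            have e2 : ((R.erase r₁).erase r₂).card + 1 = (R.erase r₁).card :=
              Finset.card_erase_add_one (Finset.mem_erase.2 ⟨ne_of_gt h12', hr₂R⟩)
            have h2 := Finset.card_le_card hsub
            omega
          have hT₂R' : T₂.card ≤ 2 * R'.card + 2 := by
            refine card_le_two_mul_card_add_two T₂ R' (fun t ht htR' => ?_) (fun x hx y hy z hz hxy hyz => ?_)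
            · have hPt := ((hmemT t).1 (Finset.mem_of_mem_filter t ht)).2
              exact hPt ((hmemR t).1 (Finset.mem_of_mem_filter t htR')).1
            · obtain ⟨hxT, hx₁, _⟩ := Finset.mem_filter.1 hx
              obtain ⟨hzT, _, hz₂⟩ := Finset.mem_filter.1 hz
              obtain ⟨⟨_, hx0⟩, hPx⟩ := (hmemT x).1 hxT
              have hyT : y ∈ T := Finset.mem_of_mem_filter y hy
              obtain ⟨⟨_, _⟩, hPy⟩ := (hmemT y).1 hyT
              obtain ⟨⟨_, _⟩, hPz⟩ := (hmemT z).1 hzT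
              -- the window `(a, b)` around `x`
              have hAne : (R.filter (fun r => r < x)).Nonempty := ⟨r₁, Finset.mem_filter.2 ⟨hr₁R, hx₁⟩⟩
              have hBne : (R.filter (fun r => x < r)).Nonempty :=
                ⟨r₂, Finset.mem_filter.2 ⟨hr₂R, (hxy.trans hyz).trans hz₂⟩⟩
              set a := (R.filter (fun r => r < x)).max' hAne with ha
              set b := (R.filter (fun r => x < r)).min' hBne with hb
              have haR : a ∈ R := Finset.mem_of_mem_filter a (Finset.max'_mem _ hAne)
              have hbR : b ∈ R := Finset.mem_of_mem_filter b (Finset.min'_mem _ hBne)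
              have hax : a < x := (Finset.mem_filter.1 (Finset.max'_mem _ hAne)).2
              have hxb : x < b := (Finset.mem_filter.1 (Finset.min'_mem _ hBne)).2
              have ha0 : 0 < a := ((hmemR a).1 haR).2
              have haroot : a ∈ P.roots.toFinset := Finset.mem_of_mem_filter a haR
              have hbroot : b ∈ P.roots.toFinset := Finset.mem_of_mem_filter b hbR
              have hwindow : ∀ ρ ∈ P.roots.toFinset, ρ ≤ a ∨ b ≤ ρ := by
                intro ρ hρ
                rcases hroot_cases ρ hρ with h | h
                · exact Or.inl (h.trans ha0.le)
                · have hρx : ρ ≠ x := fun e => hPx (e ▸ ((hmemR ρ).1 h).1)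
                  rcases lt_or_gt_of_ne hρx with hlt | hgt
                  · exact Or.inl (Finset.le_max' _ ρ (Finset.mem_filter.2 ⟨h, hlt⟩))
                  · exact Or.inr (Finset.min'_le _ ρ (Finset.mem_filter.2 ⟨h, hgt⟩))
              -- `z < b` is impossible (three zeros in one inner window)
              have hbz : b < z := by
                have hzb : z ≠ b := fun e => hPz (e ▸ ((hmemR b).1 hbR).1)
                rcases lt_or_gt_of_ne hzb with hlt | hgt
                · exact (rootKernel_inner_no_three_zeros P.roots.toFinset w (fun ρ => ρ) hwpos ha0 (hax.trans hxb) hwindow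
                    ⟨a, haroot, ha0, le_rfl⟩ ⟨b, hbroot, le_rfl⟩ ⟨hax, hxb⟩ ⟨hax.trans (hxy.trans hyz), hlt⟩ hxy hyz
                    (hFzero x (Finset.mem_of_mem_filter x hxT) hPx) (hFzero y (Finset.mem_of_mem_filter y hyT) hPy)
                    (hFzero z (Finset.mem_of_mem_filter z hzT) hPz)).elim
                · exact hgt
              refine ⟨b, Finset.mem_filter.2 ⟨hbR, hx₁.trans hxb, hbz.trans hz₂⟩, hxb, hbz⟩
          omega
      have hcard : T.card ≤ T₁.card + T₂.card + T₃.card :=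
        (Finset.card_le_card hTsub).trans ((Finset.card_union_le _ _).trans
          (Nat.add_le_add_right (Finset.card_union_le _ _) _))
      omega
  omega

/-- **Global count, one number**: for every real-rooted real polynomial `P`, `Z₊(W(P)) ≤ 2·B_mult` (`B_mult` = positive roots of `P` counted with
multiplicity).  Dense-regime bookkeeping (pen §18.2: by degree alone `Z(W) ≤ 2R − 2`); NOT evidence for `WronskianBudgetK3`. [this file's theorem] -/
theorem card_posRoots_logWronskian_le_two_mul (P : ℝ[X]) (hsplit : Multiset.card P.roots = P.natDegree) :
    ((P * (X * derivative (X * derivative P)) - (X * derivative P) ^ 2).roots.toFinset.filter (fun t => 0 < t)).card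
      ≤ 2 * Multiset.card (P.roots.filter (fun t => 0 < t)) := by
  classical
  have h := card_posRoots_logWronskian_le_of_realRooted P hsplit
  have hB : (P.roots.toFinset.filter (fun t => 0 < t)).card ≤ Multiset.card (P.roots.filter (fun t => 0 < t)) := by
    rw [← Multiset.toFinset_filter]
    exact Multiset.toFinset_card_le _
  omega

end ProductPlusOne

end Summit.ValiantsHypothesis.ValiantsHypothesis.Theorems.LacunarySymmetroidMatrixDescartes
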